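/-
Copyright (c) 2026. All rights reserved.
Released under Apache 2.0 license as described in the file LICENSE.
Authors: abc-iut cell, prover seat abc-iut-w4-d095 (gen 7; row «SB′-CONTACT», abc-iut-L4-lead m136), over abc-iut-f-101's
`DiagramRelativeFamilies.lean` (relative lifts; nothing there is restated).
-/
import Literature.AnabelianGeometry.AbsoluteAnabelian.DiagramRelativeFamilies

/-!
# Families of homotopies from relative lifts: the UNION of two data on disjoint vertex sets ([AbsTopIII] Def. 3.5 (ii), toolkit)

S. Mochizuki, *Topics in Absolute Anabelian Geometry III*, Def. 3.5 (ii) p. 75 (families of homotopies: ONE homotopy per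
boundary pair of a SATURATED set, §0 p. 26 (a)–(e)), manuscript `paper:url-5493eb38cbb7`, bib key `MochizukiAbsTopIII2015`.

abc-iut-f-101's `RelLifts` datum (`DiagramRelativeFamilies.lean`) — a set of vertices `W`, a relation `Rel` on co-verticial
paths into a vertex, homotopies `θ` on related pairs into vertices of `W`, with the four laws of Def. 3.5 (ii) — yields a
family of homotopies `relFamily` whose boundary pairs are the pairs `([σ]∘[γ₁], [σ]∘[γ₂])` with `([γ₁],[γ₂])` related at a
vertex of `W`.  This file GLUES two such data `R₁`, `R₂` whose vertex sets are DISJOINT: the union `R₁ ∪ R₂` (vertices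
`W₁ ∪ W₂`, relation and homotopies taken from whichever datum owns the vertex) is again a `RelLifts` datum as soon as the two
CROSS post-composition laws hold (a pair related at `w ∈ W₁` post-composed with a path `[t] : w → w'` into `w' ∈ W₂` is
related there, with the whiskered homotopy; and symmetrically) — `RelLifts.union`; and the family of each summand is
CONTAINED in the family of the union with the same homotopies (`relFamily_η_eq_union_left/right`).

Consumer: [AbsTopIII] Cor 5.10 (iv)(c), the compatibility of the contact structure `ℋ_{An⊢}` with the observables (row
«SB′-CONTACT»): the contact data live at the vertices `{An⊢} ∪ {𝒩⊢⊞_v}` (abc-iut-f-101 / abc-iut-L4-t3), the observables'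
`ι⊞`-pairs at the vertices `{𝒩⊞_v}`; the two are glued by this file.  Pure category theory; nothing here bears on
[IUTchIII] Cor. 3.12; no claim of the paper is asserted.
-/

namespace Literature.AnabelianGeometry.AbsoluteAnabelian

open _root_.CategoryTheory _root_.Quiver

universe v u w

namespace DiagramOfCategories

variable {V : Type w} [Quiver.{v} V] {D : DiagramOfCategories.{v, u, w} V}

namespace RelLifts

/-! ### The cross post-composition law between two relative-lift data -/

/-- **The cross law from `R₁` to `R₂`** (§0 p. 26 (e), Def. 3.5 (ii) whiskering, ACROSS the two data): a pair related at
`w ∈ W₁`, post-composed with a path `[t] : w → w'` into a vertex `w' ∈ W₂`, is related at `w'`, and its `R₂`-homotopy is the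
`R₁`-homotopy whiskered by `𝒟_[t]` (heterogeneously: `𝒟_[t∘γ] = 𝒟_[t] ∘ 𝒟_[γ]` holds only propositionally).
[cite: MochizukiAbsTopIII2015, Definition 3.5 (ii) p.75] -/
structure CrossLaw (R₁ R₂ : D.RelLifts) : Prop where
  /-- relatedness is transported along `[t]` -/
  rel : ∀ ⦃a w w' : V⦄ ⦃p q : Path a w⦄ (t : Path w w'), R₁.W w → R₂.W w' → R₁.Rel p q →
    R₂.Rel (p.comp t) (q.comp t)
  /-- the homotopy of the transported pair is the whiskered homotopy -/
  θ_heq : ∀ ⦃a w w' : V⦄ (hw : R₁.W w) (hw' : R₂.W w') ⦃p q : Path a w⦄ (t : Path w w') (h : R₁.Rel p q)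
    (h' : R₂.Rel (p.comp t) (q.comp t)), R₂.θ hw' h' ≍ Functor.whiskerRight (R₁.θ hw h) (D.pathFunctor t)

/-- If NO path leads from a vertex of `W₁` to a vertex of `W₂`, the cross law from `R₁` to `R₂` holds vacuously.
[cite: MochizukiAbsTopIII2015, Section 0 p.26] -/
theorem CrossLaw.of_isEmpty_path {R₁ R₂ : D.RelLifts}
    (h : ∀ ⦃w w' : V⦄, R₁.W w → R₂.W w' → IsEmpty (Path w w')) : CrossLaw R₁ R₂ where
  rel _ _ _ _ _ t hw hw' _ := ((h hw hw').false t).elim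
  θ_heq _ _ _ hw hw' _ _ t _ _ := ((h hw hw').false t).elim

/-! ### The union relation and the union homotopy -/

section Union

variable (R₁ R₂ : D.RelLifts)

/-- the vertex set `W₁ ∪ W₂` of the union. [cite: MochizukiAbsTopIII2015, Definition 3.5 (ii) p.75] -/
def UW (w : V) : Prop := R₁.W w ∨ R₂.W w

/-- the related pairs of the union: related in `R₁` at a vertex of `W₁`, or in `R₂` at a vertex of `W₂`.
[cite: MochizukiAbsTopIII2015, Definition 3.5 (ii) p.75] -/
def URel ⦃a w : V⦄ (p q : Path a w) : Prop := (R₁.W w ∧ R₁.Rel p q) ∨ (R₂.W w ∧ R₂.Rel p q)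

variable {R₁ R₂} (hdisj : ∀ w, R₁.W w → R₂.W w → False)

include hdisj in
/-- at a vertex of `W₁` a union-related pair is `R₁`-related (disjointness). [cite: MochizukiAbsTopIII2015, Definition 3.5 (ii) p.75] -/
theorem URel.rel₁ {a w : V} {p q : Path a w} (h₁ : R₁.W w) (h : URel R₁ R₂ p q) : R₁.Rel p q := by
  rcases h with ⟨_, h⟩ | ⟨h₂, _⟩
  · exact h
  · exact (hdisj w h₁ h₂).elim

include hdisj in
/-- at a vertex of `W₂` a union-related pair is `R₂`-related (disjointness). [cite: MochizukiAbsTopIII2015, Definition 3.5 (ii) p.75] -/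
theorem URel.rel₂ {a w : V} {p q : Path a w} (h₂ : R₂.W w) (h : URel R₁ R₂ p q) : R₂.Rel p q := by
  rcases h with ⟨h₁, _⟩ | ⟨_, h⟩
  · exact (hdisj w h₁ h₂).elim
  · exact h

open scoped Classical in
/-- the homotopy of a union-related pair into a vertex of `W₁ ∪ W₂`: `θ₁` or `θ₂` according to the owner of the vertex.
[cite: MochizukiAbsTopIII2015, Definition 3.5 (ii) p.75] -/
noncomputable def Uθ ⦃a w : V⦄ (hw : UW R₁ R₂ w) ⦃p q : Path a w⦄ (h : URel R₁ R₂ p q) :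
    D.pathFunctor p ⟶ D.pathFunctor q :=
  if h₁ : R₁.W w then R₁.θ h₁ (URel.rel₁ hdisj h₁ h)
  else R₂.θ (hw.resolve_left h₁) (URel.rel₂ hdisj (hw.resolve_left h₁) h)

/-- at a vertex of `W₁` the union homotopy is `θ₁`. [cite: MochizukiAbsTopIII2015, Definition 3.5 (ii) p.75] -/
theorem Uθ_eq₁ {a w : V} (hw : UW R₁ R₂ w) (h₁ : R₁.W w) {p q : Path a w} (h : URel R₁ R₂ p q) :
    Uθ hdisj hw h = R₁.θ h₁ (URel.rel₁ hdisj h₁ h) := by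
  unfold Uθ
  rw [dif_pos h₁]

/-- at a vertex of `W₂` the union homotopy is `θ₂`. [cite: MochizukiAbsTopIII2015, Definition 3.5 (ii) p.75] -/
theorem Uθ_eq₂ {a w : V} (hw : UW R₁ R₂ w) (h₂ : R₂.W w) {p q : Path a w} (h : URel R₁ R₂ p q) :
    Uθ hdisj hw h = R₂.θ h₂ (URel.rel₂ hdisj h₂ h) := by
  unfold Uθ
  rw [dif_neg (fun h₁ => hdisj w h₁ h₂)]

/-! ### The union is a relative-lift datum -/

/-- **The union `R₁ ∪ R₂` of two relative-lift data on DISJOINT vertex sets, given both cross laws, is a relative-lift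
datum**: the saturation moves §0 (a), (c), (d) and the laws of Def. 3.5 (ii) for them hold vertex by vertex inside the
owner of the vertex; the post-composition move (e) along `[t] : w → w'` holds inside one datum when `w, w'` have the same
owner and by the cross laws otherwise. [cite: MochizukiAbsTopIII2015, Definition 3.5 (ii) p.75] -/
noncomputable def union (h₁₂ : CrossLaw R₁ R₂) (h₂₁ : CrossLaw R₂ R₁) : D.RelLifts where
  W := UW R₁ R₂
  Rel := URel R₁ R₂
  θ := fun _ _ hw _ _ h => Uθ hdisj hw h
  rel_refl_left := by
    rintro a w p q - (⟨hw, h⟩ | ⟨hw, h⟩)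
    · exact Or.inl ⟨hw, R₁.rel_refl_left hw h⟩
    · exact Or.inr ⟨hw, R₂.rel_refl_left hw h⟩
  rel_refl_right := by
    rintro a w p q - (⟨hw, h⟩ | ⟨hw, h⟩)
    · exact Or.inl ⟨hw, R₁.rel_refl_right hw h⟩
    · exact Or.inr ⟨hw, R₂.rel_refl_right hw h⟩
  rel_trans := by
    rintro a w p q r - (⟨hw, h⟩ | ⟨hw, h⟩) (⟨hw', h'⟩ | ⟨hw', h'⟩)
    · exact Or.inl ⟨hw, R₁.rel_trans hw h h'⟩
    · exact (hdisj w hw hw').elim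
    · exact (hdisj w hw' hw).elim
    · exact Or.inr ⟨hw, R₂.rel_trans hw h h'⟩
  rel_precomp := by
    rintro c a w r p q - (⟨hw, h⟩ | ⟨hw, h⟩)
    · exact Or.inl ⟨hw, R₁.rel_precomp r hw h⟩
    · exact Or.inr ⟨hw, R₂.rel_precomp r hw h⟩
  rel_postcomp := by
    rintro a w w' p q t - (hw' | hw') (⟨hw, h⟩ | ⟨hw, h⟩)
    · exact Or.inl ⟨hw', R₁.rel_postcomp t hw hw' h⟩
    · exact Or.inl ⟨hw', h₂₁.rel t hw hw' h⟩
    · exact Or.inr ⟨hw', h₁₂.rel t hw hw' h⟩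
    · exact Or.inr ⟨hw', R₂.rel_postcomp t hw hw' h⟩
  θ_self := by
    intro a w hw p h
    rcases hw with hw₁ | hw₂
    · rw [Uθ_eq₁ hdisj _ hw₁]
      exact R₁.θ_self hw₁ _
    · rw [Uθ_eq₂ hdisj _ hw₂]
      exact R₂.θ_self hw₂ _
  θ_trans := by
    intro a w hw p q r h h' h''
    rcases hw with hw₁ | hw₂
    · rw [Uθ_eq₁ hdisj _ hw₁, Uθ_eq₁ hdisj _ hw₁, Uθ_eq₁ hdisj _ hw₁]
      exact R₁.θ_trans hw₁ _ _ _
    · rw [Uθ_eq₂ hdisj _ hw₂, Uθ_eq₂ hdisj _ hw₂, Uθ_eq₂ hdisj _ hw₂]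
      exact R₂.θ_trans hw₂ _ _ _
  θ_precomp_heq := by
    intro c a w hw r p q h h'
    rcases hw with hw₁ | hw₂
    · rw [Uθ_eq₁ hdisj _ hw₁, Uθ_eq₁ hdisj _ hw₁]
      exact R₁.θ_precomp_heq hw₁ r _ _
    · rw [Uθ_eq₂ hdisj _ hw₂, Uθ_eq₂ hdisj _ hw₂]
      exact R₂.θ_precomp_heq hw₂ r _ _
  θ_postcomp_heq := by
    intro a w w' hw hw' p q t h h'
    rcases hw with hw₁ | hw₂ <;> rcases hw' with hw₁' | hw₂'
    · rw [Uθ_eq₁ hdisj _ hw₁, Uθ_eq₁ hdisj _ hw₁']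
      exact R₁.θ_postcomp_heq hw₁ hw₁' t _ _
    · rw [Uθ_eq₁ hdisj _ hw₁, Uθ_eq₂ hdisj _ hw₂']
      exact h₁₂.θ_heq hw₁ hw₂' t _ _
    · rw [Uθ_eq₂ hdisj _ hw₂, Uθ_eq₁ hdisj _ hw₁']
      exact h₂₁.θ_heq hw₂ hw₁' t _ _
    · rw [Uθ_eq₂ hdisj _ hw₂, Uθ_eq₂ hdisj _ hw₂']
      exact R₂.θ_postcomp_heq hw₂ hw₂' t _ _

variable (h₁₂ : CrossLaw R₁ R₂) (h₂₁ : CrossLaw R₂ R₁)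

/-- the vertex set of the union is `W₁ ∪ W₂`. [cite: MochizukiAbsTopIII2015, Definition 3.5 (ii) p.75] -/
theorem union_W (w : V) : (union hdisj h₁₂ h₂₁).W w ↔ R₁.W w ∨ R₂.W w := Iff.rfl

/-- the related pairs of the union. [cite: MochizukiAbsTopIII2015, Definition 3.5 (ii) p.75] -/
theorem union_rel_iff {a w : V} (p q : Path a w) :
    (union hdisj h₁₂ h₂₁).Rel p q ↔ (R₁.W w ∧ R₁.Rel p q) ∨ (R₂.W w ∧ R₂.Rel p q) := Iff.rfl

/-- an `R₁`-related pair at a vertex of `W₁` is related in the union. [cite: MochizukiAbsTopIII2015, Definition 3.5 (ii) p.75] -/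
theorem union_rel_of_left {a w : V} {p q : Path a w} (hw : R₁.W w) (h : R₁.Rel p q) :
    (union hdisj h₁₂ h₂₁).Rel p q := Or.inl ⟨hw, h⟩

/-- an `R₂`-related pair at a vertex of `W₂` is related in the union. [cite: MochizukiAbsTopIII2015, Definition 3.5 (ii) p.75] -/
theorem union_rel_of_right {a w : V} {p q : Path a w} (hw : R₂.W w) (h : R₂.Rel p q) :
    (union hdisj h₁₂ h₂₁).Rel p q := Or.inr ⟨hw, h⟩

/-- the union homotopy at a vertex of `W₁` is `θ₁`. [cite: MochizukiAbsTopIII2015, Definition 3.5 (ii) p.75] -/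
theorem union_θ_left {a w : V} (hw₁ : R₁.W w) (hw : (union hdisj h₁₂ h₂₁).W w) {p q : Path a w} (h₁ : R₁.Rel p q)
    (h : (union hdisj h₁₂ h₂₁).Rel p q) : (union hdisj h₁₂ h₂₁).θ hw h = R₁.θ hw₁ h₁ :=
  Uθ_eq₁ hdisj hw hw₁ h

/-- the union homotopy at a vertex of `W₂` is `θ₂`. [cite: MochizukiAbsTopIII2015, Definition 3.5 (ii) p.75] -/
theorem union_θ_right {a w : V} (hw₂ : R₂.W w) (hw : (union hdisj h₁₂ h₂₁).W w) {p q : Path a w} (h₂ : R₂.Rel p q)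
    (h : (union hdisj h₁₂ h₂₁).Rel p q) : (union hdisj h₁₂ h₂₁).θ hw h = R₂.θ hw₂ h₂ :=
  Uθ_eq₂ hdisj hw hw₂ h

/-! ### The families of the summands are contained in the family of the union -/

/-- a decomposition through an `R₁`-related pair is a decomposition through a union-related pair.
[cite: MochizukiAbsTopIII2015, Definition 3.5 (iv) p.76] -/
def RDecomp.toUnionLeft {a b : V} {P Q : Path a b} (d : RDecomp R₁ P Q) : RDecomp (union hdisj h₁₂ h₂₁) P Q :=
  ⟨d.w, Or.inl d.mem, d.p, d.q, d.s, Or.inl ⟨d.mem, d.rel⟩, d.left_eq, d.right_eq⟩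

/-- a decomposition through an `R₂`-related pair is a decomposition through a union-related pair.
[cite: MochizukiAbsTopIII2015, Definition 3.5 (iv) p.76] -/
def RDecomp.toUnionRight {a b : V} {P Q : Path a b} (d : RDecomp R₂ P Q) : RDecomp (union hdisj h₁₂ h₂₁) P Q :=
  ⟨d.w, Or.inr d.mem, d.p, d.q, d.s, Or.inr ⟨d.mem, d.rel⟩, d.left_eq, d.right_eq⟩

/-- the decomposition homotopy is unchanged when a decomposition through `R₁` is read in the union.
[cite: MochizukiAbsTopIII2015, Definition 3.5 (iv) p.76] -/
theorem RDecomp.η_toUnionLeft {a b : V} {P Q : Path a b} (d : RDecomp R₁ P Q) :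
    (RDecomp.toUnionLeft hdisj h₁₂ h₂₁ d).η (union hdisj h₁₂ h₂₁) = d.η R₁ := by
  unfold RDecomp.η
  erw [union_θ_left hdisj h₁₂ h₂₁ d.mem _ d.rel]
  rfl

/-- the decomposition homotopy is unchanged when a decomposition through `R₂` is read in the union.
[cite: MochizukiAbsTopIII2015, Definition 3.5 (iv) p.76] -/
theorem RDecomp.η_toUnionRight {a b : V} {P Q : Path a b} (d : RDecomp R₂ P Q) :
    (RDecomp.toUnionRight hdisj h₁₂ h₂₁ d).η (union hdisj h₁₂ h₂₁) = d.η R₂ := by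
  unfold RDecomp.η
  erw [union_θ_right hdisj h₁₂ h₂₁ d.mem _ d.rel]
  rfl

/-- **the boundary set of `R₁`'s family is contained in that of the union.** [cite: MochizukiAbsTopIII2015, Definition 3.5 (ii) p.75] -/
theorem relE_union_of_left {a b : V} {P Q : Path a b} (h : relE R₁ P Q) : relE (union hdisj h₁₂ h₂₁) P Q :=
  ⟨RDecomp.toUnionLeft hdisj h₁₂ h₂₁ (Classical.choice h)⟩

/-- **the boundary set of `R₂`'s family is contained in that of the union.** [cite: MochizukiAbsTopIII2015, Definition 3.5 (ii) p.75] -/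
theorem relE_union_of_right {a b : V} {P Q : Path a b} (h : relE R₂ P Q) : relE (union hdisj h₁₂ h₂₁) P Q :=
  ⟨RDecomp.toUnionRight hdisj h₁₂ h₂₁ (Classical.choice h)⟩

/-- **`R₁`'s family is a SUB-family of the union's family**: same homotopy on every boundary pair of `R₁`'s family (Def. 3.5
(ii): compatible families). [cite: MochizukiAbsTopIII2015, Definition 3.5 (ii) p.75] -/
theorem relFamily_η_eq_union_left {a b : V} {P Q : Path a b} (h : (relFamily R₁).E P Q)
    (h' : (relFamily (union hdisj h₁₂ h₂₁)).E P Q) :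
    (relFamily R₁).η h = (relFamily (union hdisj h₁₂ h₂₁)).η h' := by
  rw [relFamily_η_eq R₁ h (Classical.choice h),
    relFamily_η_eq (union hdisj h₁₂ h₂₁) h' (RDecomp.toUnionLeft hdisj h₁₂ h₂₁ (Classical.choice h)),
    RDecomp.η_toUnionLeft]

/-- **`R₂`'s family is a SUB-family of the union's family.** [cite: MochizukiAbsTopIII2015, Definition 3.5 (ii) p.75] -/
theorem relFamily_η_eq_union_right {a b : V} {P Q : Path a b} (h : (relFamily R₂).E P Q)
    (h' : (relFamily (union hdisj h₁₂ h₂₁)).E P Q) :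
    (relFamily R₂).η h = (relFamily (union hdisj h₁₂ h₂₁)).η h' := by
  rw [relFamily_η_eq R₂ h (Classical.choice h),
    relFamily_η_eq (union hdisj h₁₂ h₂₁) h' (RDecomp.toUnionRight hdisj h₁₂ h₂₁ (Classical.choice h)),
    RDecomp.η_toUnionRight]

/-- the containment of `R₁`'s family, packaged: every boundary pair of `relFamily R₁` is a boundary pair of the union's family
with the same homotopy. [cite: MochizukiAbsTopIII2015, Definition 3.5 (ii) p.75] -/
theorem relFamily_sub_union_left {a b : V} (P Q : Path a b) (h : (relFamily R₁).E P Q) :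
    ∃ h' : (relFamily (union hdisj h₁₂ h₂₁)).E P Q, (relFamily R₁).η h = (relFamily (union hdisj h₁₂ h₂₁)).η h' :=
  ⟨relE_union_of_left hdisj h₁₂ h₂₁ h, relFamily_η_eq_union_left hdisj h₁₂ h₂₁ h _⟩

/-- the containment of `R₂`'s family, packaged. [cite: MochizukiAbsTopIII2015, Definition 3.5 (ii) p.75] -/
theorem relFamily_sub_union_right {a b : V} (P Q : Path a b) (h : (relFamily R₂).E P Q) :
    ∃ h' : (relFamily (union hdisj h₁₂ h₂₁)).E P Q, (relFamily R₂).η h = (relFamily (union hdisj h₁₂ h₂₁)).η h' :=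
  ⟨relE_union_of_right hdisj h₁₂ h₂₁ h, relFamily_η_eq_union_right hdisj h₁₂ h₂₁ h _⟩

/-- **on a RELATED pair into a vertex of `W₂` the union's family has homotopy `θ₂`** (abc-iut-f-101's `relFamily_η_eq_θ` read
for the union). [cite: MochizukiAbsTopIII2015, Definition 3.5 (ii) p.75] -/
theorem relFamily_union_η_eq_θ_right {a w : V} (hw : R₂.W w) {p q : Path a w} (hr : R₂.Rel p q)
    (h : (relFamily (union hdisj h₁₂ h₂₁)).E p q) : (relFamily (union hdisj h₁₂ h₂₁)).η h = R₂.θ hw hr := by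
  rw [relFamily_η_eq_θ (union hdisj h₁₂ h₂₁) (Or.inr hw) (Or.inr ⟨hw, hr⟩) h, union_θ_right hdisj h₁₂ h₂₁ hw]

/-- on a related pair into a vertex of `W₁` the union's family has homotopy `θ₁`. [cite: MochizukiAbsTopIII2015, Definition 3.5 (ii) p.75] -/
theorem relFamily_union_η_eq_θ_left {a w : V} (hw : R₁.W w) {p q : Path a w} (hr : R₁.Rel p q)
    (h : (relFamily (union hdisj h₁₂ h₂₁)).E p q) : (relFamily (union hdisj h₁₂ h₂₁)).η h = R₁.θ hw hr := by
  rw [relFamily_η_eq_θ (union hdisj h₁₂ h₂₁) (Or.inl hw) (Or.inl ⟨hw, hr⟩) h, union_θ_left hdisj h₁₂ h₂₁ hw]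

end Union

end RelLifts

end DiagramOfCategories

end Literature.AnabelianGeometry.AbsoluteAnabelian
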